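import Summits.CriticalPhenomena.PercolationContinuityZ3.Theorems.PercNearOneGluingNoHeavyLowerTailStarSetFamilySwap
import Summits.CriticalPhenomena.PercolationContinuityZ3.Theorems.PercNearOneGluingNoHeavyLowerTailStarSetFamilySwapData
import Summits.CriticalPhenomena.PercolationContinuityZ3.Theorems.PercNearOneGluingNoHeavyLowerTailStarSetFamilySwapUnits
import Summits.CriticalPhenomena.PercolationContinuityZ3.Theorems.PercNearOneGluingNoHeavyLowerTailStarSetSwapCredit
import Summits.CriticalPhenomena.PercolationContinuityZ3.Theorems.PercNearOneGluingNoHeavyLowerTailStarSetSwapNoCollision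
import HarnessLib

/-!
# `NoHeavyLowerTail` (stmt-CriticalPhenomena-4575) — the swap family from the unit data (U1-PROOF §5; blueprint §G5/§G6)

Support file (prover `prim-gen-swap` gen 13; `--supports stmt-CriticalPhenomena-4575`).  No definitions, no named facts, no sorries.

Discharges the structural hypotheses of `familySwap_bound` from per-unit data of the assembly: a swap unit `(S, X)` with port `d = prt u ∈ X`
(`X ∈ S` an r-free chord adjacent to every class of `S`), the child edge `child d ∈ F` with ports `(r, d)`, `child d ∉ S`, `θ_X ≤ θ_{child d}`,
a `d`-avoiding class in `S` ((Φ2)), and the case datum of `swap_targets_one_port` (STAR through a port `v ≠ r` with a second chord, or the least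
F-class `J ∉ Ch` of `S` above the child edge).  Then: weight monotonicity (`swap_weight_ge`), same target ⇒ same port (`swap_targets_one_port`),
the r-free triangle of a two-element fibre (`swap_two_fibre_triangle`, `triangle_min_rotations_le_cap`), and at most two units per target
(`swap_no_three`); hence `Σ_{u∈U} W(S_u) ≤ Σ_{targets} W + (3/8)·Σ_{T ∈ TRIS} C_T` for any `TRIS` containing all r-free triangles.

* `StarSet.familySwap_of_units`.
-/

namespace Summit.CriticalPhenomena.PercolationContinuityZ3.Theorems

open Finset
open scoped BigOperators Classical

namespace StarSet

variable {ι V : Type*} [Fintype ι] [LinearOrder ι] [DecidableEq V]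

/-- **The swap family from the unit data (blueprint §G5/§G6).** -/
theorem familySwap_of_units (P P' : ι → V) (hPP' : ∀ X, P X ≠ P' X)
    (hinj : Function.Injective fun X => (s(P X, P' X) : Sym2 V)) (r : V) (F : Finset ι)
    (hforest : ∀ K ∈ F, ∀ I ∈ F, K < I → P' K ≠ P I ∧ P' K ≠ P' I)
    (θ : ι → ℝ) (hθ0 : ∀ X, 0 ≤ θ X) (hθ1 : ∀ X, θ X ≤ 1) (O : ι → V → ℝ) (hO0 : ∀ X d, 0 ≤ O X d) (Φ : ι → ℝ)
    (hO2 : ∀ X, Φ X ^ 2 ≤ O X (P X) * O X (P' X)) (hΦ4 : ∀ X, 4 * θ X ≤ Φ X) (hΦsq : ∀ X, θ X ≤ Φ X ^ 2)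
    (TRIS : Finset (Finset ι))
    (hTRIS : ∀ (a b c : V) (X Y Z : ι), a ≠ b → a ≠ c → b ≠ c → a ≠ r → b ≠ r → c ≠ r →
      (s(P X, P' X) : Sym2 V) = s(a, b) → (s(P Y, P' Y) : Sym2 V) = s(a, c) → (s(P Z, P' Z) : Sym2 V) = s(b, c) →
      ({X, Y, Z} : Finset ι) ∈ TRIS)
    (U : Finset (Finset ι × ι)) (prt : Finset ι × ι → V) (child : V → ι)
    (hU : ∀ u ∈ U, u.2 ∈ u.1 ∧ u.2 ∉ F ∧ P u.2 ≠ r ∧ P' u.2 ≠ r ∧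
      (∀ Y ∈ u.1, P u.2 = P Y ∨ P u.2 = P' Y ∨ P' u.2 = P Y ∨ P' u.2 = P' Y) ∧
      (P u.2 = prt u ∨ P' u.2 = prt u) ∧ child (prt u) ∈ F ∧ P (child (prt u)) = r ∧ P' (child (prt u)) = prt u ∧
      child (prt u) ∉ u.1 ∧ θ u.2 ≤ θ (child (prt u)) ∧ (∃ Y ∈ u.1, P Y ≠ prt u ∧ P' Y ≠ prt u) ∧
      ((∃ v, v ≠ r ∧ (∀ Y ∈ u.1, P Y = v ∨ P' Y = v) ∧ ∃ X' ∈ u.1, X' ≠ u.2 ∧ X' ∉ F) ∨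
       (∃ J ∈ u.1, J ∈ F ∧ (∀ I ∈ u.1, I ∈ F → J ≤ I) ∧ P J ≠ r ∧ child (prt u) < J))) :
    ∑ u ∈ U, ((∏ k ∈ u.1, θ k) * ∏ k ∈ univ \ u.1, (1 - θ k)) ≤
      ∑ ω ∈ U.image (fun u => insert (child (prt u)) (u.1.erase u.2)), ((∏ k ∈ ω, θ k) * ∏ k ∈ univ \ ω, (1 - θ k)) +
        (3 / 8) * ∑ T ∈ TRIS, ∑ δ ∈ (univ : Finset (ι → Bool)).filter (fun δ => (∀ K ∉ T, δ K = false) ∧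
            3 ≤ (T.image fun K => if δ K then P K else P' K).card ∧ r ∉ T.image fun K => if δ K then P K else P' K),
          ∏ K ∈ T, O K (if δ K then P K else P' K) := by
  set C : Finset ι → ℝ := fun T => ∑ δ ∈ (univ : Finset (ι → Bool)).filter (fun δ => (∀ K ∉ T, δ K = false) ∧
      3 ≤ (T.image fun K => if δ K then P K else P' K).card ∧ r ∉ T.image fun K => if δ K then P K else P' K),
    ∏ K ∈ T, O K (if δ K then P K else P' K) with hC
  have hC0 : ∀ T, 0 ≤ C T := fun T => sum_nonneg fun δ _ => prod_nonneg fun K _ => hO0 _ _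
  set tgt : Finset ι × ι → Finset ι := fun u => insert (child (prt u)) (u.1.erase u.2) with htgt
  -- membership in a configuration versus its target
  have hmemS : ∀ u ∈ U, ∀ Y, Y ∈ u.1 ↔ Y = u.2 ∨ (Y ∈ tgt u ∧ Y ≠ child (prt u)) := by
    intro u hu Y
    obtain ⟨hXS, -, -, -, -, -, -, -, -, hAS, -⟩ := hU u hu
    simp only [htgt, mem_insert, mem_erase]
    constructor
    · intro hY
      by_cases h : Y = u.2
      · exact Or.inl h
      · exact Or.inr ⟨Or.inr ⟨h, hY⟩, fun hYA => hAS (hYA ▸ hY)⟩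
    · rintro (rfl | ⟨rfl | ⟨-, hY⟩, hne⟩)
      · exact hXS
      · exact absurd rfl hne
      · exact hY
  -- (1) same target ⇒ same port (U1-PROOF L5.2′)
  have hport : ∀ u ∈ U, ∀ v ∈ U, tgt u = tgt v → prt u = prt v := by
    intro u hu v hv heq
    by_contra hd
    obtain ⟨-, hXF, hXr, hX'r, hadj, hXd, hAF, hAr, hAd, -, -, -, hcase⟩ := hU u hu
    obtain ⟨-, hX₂F, -, -, -, -, hA₂F, hA₂r, hA₂d, -, -, -, hcase₂⟩ := hU v hv
    have hA₁ω : child (prt u) ∈ tgt u := by simp only [htgt]; exact mem_insert_self _ _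
    have hA₂ω : child (prt v) ∈ tgt u := by rw [heq]; simp only [htgt]; exact mem_insert_self _ _
    have hS₂ : ∀ Y, Y ∈ v.1 ↔ Y = v.2 ∨ (Y ∈ tgt u ∧ Y ≠ child (prt v)) := by rw [heq]; exact hmemS v hv
    exact swap_targets_one_port P P' hinj r F hforest hd hAF ⟨hAr, hAd⟩ hA₂F ⟨hA₂r, hA₂d⟩ hXF ⟨hXr, hX'r⟩ hXd hX₂F
      (tgt u) u.1 v.1 hA₁ω hA₂ω (hmemS u hu) hS₂ hadj hcase hcase₂
  -- same target ⇒ same `Z`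
  have hZ : ∀ u ∈ U, ∀ v ∈ U, tgt u = tgt v → v.1.erase v.2 = u.1.erase u.2 := by
    intro u hu v hv heq
    have hp := hport u hu v hv heq
    have hAu : child (prt u) ∉ u.1.erase u.2 := fun h => (hU u hu).2.2.2.2.2.2.2.2.2.1 (mem_of_mem_erase h)
    have hAv : child (prt u) ∉ v.1.erase v.2 := by
      rw [hp]; exact fun h => (hU v hv).2.2.2.2.2.2.2.2.2.1 (mem_of_mem_erase h)
    have h := heq
    simp only [htgt] at h
    rw [← hp] at h
    rw [← erase_insert hAv, ← erase_insert hAu, h]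
  -- same target, distinct units ⇒ distinct hubs
  have hhub : ∀ u ∈ U, ∀ v ∈ U, u ≠ v → tgt u = tgt v → u.2 ≠ v.2 := by
    intro u hu v hv huv heq h
    apply huv
    have hz := hZ u hu v hv heq
    have h1 : u.1 = v.1 := by
      rw [← insert_erase (hU u hu).1, ← insert_erase (hU v hv).1, hz, h]
    exact Prod.ext h1 h
  -- ports of an r-free chord avoid `r`
  have hnr : ∀ u ∈ U, ∀ w, (P u.2 = w ∨ P' u.2 = w) → w ≠ r := by
    intro u hu w hw
    rcases hw with h | h <;> rw [← h]
    · exact (hU u hu).2.2.1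
    · exact (hU u hu).2.2.2.1
  refine familySwap_bound P P' hinj θ hθ0 hθ1 TRIS C hC0 U (fun u => u.1.erase u.2) prt child
    (fun u hu => ?_) (fun u hu v hv huv heq => ?_) (fun u hu v hv w hw huv huw => ?_)
  · -- hU of familySwap_bound
    obtain ⟨hXS, -, -, -, -, hXd, -, -, -, hAS, hθA, -, -⟩ := hU u hu
    exact ⟨(insert_erase hXS).symm, notMem_erase _ _, fun h => hAS (mem_of_mem_erase h), hXd,
      swap_weight_ge θ hθ0 hθ1 u.1 u.2 (child (prt u)) hXS hAS hθA⟩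
  · -- hpair
    have hp := hport u hu v hv heq
    refine ⟨hp, ?_⟩
    obtain ⟨hXS, hXF, hXr, hX'r, hadj, hXd, -, -, -, -, -, ⟨Y, hYS, hYd, hY'd⟩, -⟩ := hU u hu
    obtain ⟨hX₂S, -, hX₂r, hX₂'r, hadj₂, hX₂d, -⟩ := hU v hv
    have hz := hZ u hu v hv heq
    have hYX : Y ≠ u.2 := by
      rintro rfl
      rcases hXd with h | h
      · exact hYd h
      · exact hY'd h
    have hYZ : Y ∈ u.1.erase u.2 := mem_erase.2 ⟨hYX, hYS⟩
    have hYv : Y ∈ v.1 := by rw [← insert_erase hX₂S, hz]; exact mem_insert_of_mem hYZ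
    have hXX' : u.2 ≠ v.2 := hhub u hu v hv huv heq
    have hX₂d' : P v.2 = prt u ∨ P' v.2 = prt u := by rw [hp]; exact hX₂d
    obtain ⟨a, b, hab, hda, hdb, hXpair, hX'pair, hYpair⟩ :=
      swap_two_fibre_triangle P P' hPP' hinj hXX' hXd hX₂d' ⟨hYd, hY'd⟩ (hadj Y hYS) (hadj₂ Y hYv)
    have hdr : prt u ≠ r := hnr u hu _ hXd
    have har : a ≠ r := hnr u hu a ((ports_iff_of_pair P P' hXpair a).2 (Or.inr rfl))
    have hbr : b ≠ r := hnr v hv b ((ports_iff_of_pair P P' hX'pair b).2 (Or.inr rfl))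
    have hYX₂ : Y ≠ v.2 := by
      rintro rfl
      rcases hX₂d' with h | h
      · exact hYd h
      · exact hY'd h
    refine ⟨Y, hYZ, hTRIS (prt u) a b u.2 v.2 Y hda hdb hab hdr har hbr hXpair hX'pair hYpair, ?_, ?_⟩
    · rw [card_insert_of_notMem (by simp [hXX', hYX.symm]), card_pair hYX₂.symm]
    · have h := triangle_min_rotations_le_cap P P' r θ hθ0 O hO0 Φ hO2 hΦ4 hΦsq hda hdb hab hdr har hbr hXpair hX'pair hYpair
      simp only [hC]; exact h
  · -- htwo
    by_contra hne
    push Not at hne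
    obtain ⟨huv', huw', hvw'⟩ := hne
    obtain ⟨hXS, -, -, -, hadj, hXd, -, -, -, -, -, ⟨Y, hYS, hYd, hY'd⟩, -⟩ := hU u hu
    have hpv := hport u hu v hv huv
    have hpw := hport u hu w hw huw
    have hzv := hZ u hu v hv huv
    have hzw := hZ u hu w hw huw
    have hYX : Y ≠ u.2 := by
      rintro rfl
      rcases hXd with h | h
      · exact hYd h
      · exact hY'd h
    have hYZ : Y ∈ u.1.erase u.2 := mem_erase.2 ⟨hYX, hYS⟩
    have hYv : Y ∈ v.1 := by rw [← insert_erase (hU v hv).1, hzv]; exact mem_insert_of_mem hYZ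
    have hYw : Y ∈ w.1 := by rw [← insert_erase (hU w hw).1, hzw]; exact mem_insert_of_mem hYZ
    have h12 := hhub u hu v hv huv' huv
    have h13 := hhub u hu w hw huw' huw
    have h23 : v.2 ≠ w.2 := hhub v hv w hw hvw' (huv.symm.trans huw)
    have hdv : P v.2 = prt u ∨ P' v.2 = prt u := by rw [hpv]; exact (hU v hv).2.2.2.2.2.1
    have hdw : P w.2 = prt u ∨ P' w.2 = prt u := by rw [hpw]; exact (hU w hw).2.2.2.2.2.1
    exact swap_no_three P P' hinj ⟨hYd, hY'd⟩ h12 h13 h23 ⟨hXd, hadj Y hYS⟩ ⟨hdv, (hU v hv).2.2.2.2.1 Y hYv⟩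
      ⟨hdw, (hU w hw).2.2.2.2.1 Y hYw⟩

end StarSet

end Summit.CriticalPhenomena.PercolationContinuityZ3.Theorems
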